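import Mathlib.Algebra.BigOperators.NatAntidiagonal
import Literature.Analysis.ODE.LieCoefficientRecursions
import Literature.Analysis.ValidatedNumerics.SparsePolynomialEnclosure
import Literature.Analysis.ValidatedNumerics.IntervalFunctions
import Literature.Analysis.ValidatedNumerics.IntervalLogArctan
import Literature.Analysis.ValidatedNumerics.TaylorModelSinCos
import HarnessLib

/-!
# Interval Taylor-series arithmetic (Moore's recursive generation of Taylor coefficients)

Moore 1979, §3.4 ("Recursive evaluation of derivatives") computes the Taylor coefficients
`(x)_k = (1/k!) x^{(k)}(t₀)` of every function built from arithmetic operations and elementary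
functions by *recurrence relations*, one per node of the code list (eqs. (3.17)–(3.19) and the
general procedure, steps 1–4):

* `(u ± v)_k = (u)_k ± (v)_k`, `(uv)_k = ∑_{j ≤ k} (u)_j (v)_{k−j}`,
  `(u/v)_k = (1/v) { (u)_k − ∑_{j=1}^{k} (v)_j (u/v)_{k−j} }`                       — (3.18);
* `(eᵘ)_k = ∑_{j<k} (1 − j/k) (eᵘ)_j (u)_{k−j}`,
  `(log u)_k = (1/u) ( (u)_k − ∑_{0<j<k} (1 − j/k) (u)_j (log u)_{k−j} )`,
  `(sin u)_k = (1/k) ∑_{j<k} (j+1) (cos u)_{k−1−j} (u)_{j+1}`,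
  `(cos u)_k = −(1/k) ∑_{j<k} (j+1) (sin u)_{k−1−j} (u)_{j+1}`, `(u^{1/2})_k`, …        — (3.19).

Evaluated in *interval arithmetic* the same recurrences produce enclosures of the Taylor
coefficients over a box of expansion points (Moore 1979 §3.4, paragraph before (3.20);
Moore 1966 Ch. 11) — the "interval Taylor series" / Taylor-AD layer of every interval ODE
solver (Lohner's AWA; VNODE: Nedialkov–Jackson–Corliss 1999 §§3–4; Griewank–Walther 2008 §13.2,
Table 13.2 "Taylor coefficient propagation through univariate elementals").

This file implements that layer over `NonemptyInterval ℚ` and proves its **inclusion property**: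

* `ITaylor.SeqMem n a A` — the list `A` of `n` rational intervals encloses the real sequence
  `a : ℕ → ℝ` coefficientwise below the truncation order `n`;
* the series operations `addS`, `subS`, `negS`, `smulS`, `constS`, `mulS`, `powS`, `expS`,
  `logS`, `sinCosS`, `invS`, `divS`, `sqrtS` (Moore's recurrences, each new coefficient rounded
  outward to `prec` binary digits; the transcendental *seeds* `(eᵘ)_0 = e^{(u)_0}`, … are
  pluggable partial interval maps `NonemptyInterval ℚ → Option (NonemptyInterval ℚ)` with the
  soundness predicates `SeedSound`, `SeedSoundOn`, `SeedSound₂`);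
* the inclusion theorems `seqMem_addS`, …, `seqMem_sqrtS`: if the input sequences are enclosed and
  the output sequence satisfies the (real) recurrence identity of the node, it is enclosed by the
  computed list;
* the **bridge to Lie coefficients** (`coeffSeq`, `seqMem_coeffSeq_*`): for a derivation `D` of a
  commutative `ℝ`-algebra `A` and an evaluation `φ : A →ₐ[ℝ] ℝ`, the sequences
  `k ↦ φ (lieCoeff D k a)` satisfy exactly these identities (the rules of
  `Literature.Analysis.ODE.LieCoefficientRecursions`), so the interval recurrences enclose the
  Taylor coefficients of `exp u`, `log u`, `sin u`, `cos u`, `1/v`, `u/v`, `√a`, `u·v`, `uᵐ`, …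
  along the flow of any smooth vector field (`A` = germs of smooth functions, `D` = Lie derivative);
* concrete seeds (`Seed.exp`, `Seed.log`, `Seed.sinCos`, `Seed.sqrt`) obtained from the
  fixed-point multiprecision kernels `MI.exp`, `MI.logPos`, `PolyMP.cisPt` and `sqrtI` of this
  library, with their soundness.

Everything is computable and reduces in the kernel (`decide`), so the file is the arithmetic back
end of kernel-checked Taylor enclosure certificates for elementary (non-polynomial) vector fields.
-/

open Finset NonemptyInterval
open Literature.Analysis.ODE

namespace Literature.Analysis.ValidatedNumerics

namespace ITaylor

/-- Rational intervals — the coefficient type of interval Taylor series (lists of `Iv`).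
[folklore] -/
abbrev Iv : Type := NonemptyInterval ℚ

/-! ### Coefficient lists -/

section Lists

variable {β : Type*} [Zero β]

/-- The `k`-th entry `(x)_k` of a coefficient list (`0` beyond its length, i.e. beyond the
truncation order). [cite: Moore1979, §3.4 eq. (3.13)] -/
def coeff (A : List β) (k : ℕ) : β := A.getD k 0

/-- The list `[f 0, …, f (m-1)]` of the first `m` coefficients.
[cite: Moore1979, §3.4 eq. (3.15)] -/
def mkS (m : ℕ) (f : ℕ → β) : List β := (List.range m).map f

omit [Zero β] in
/-- [folklore] -/
private theorem length_mkS (m : ℕ) (f : ℕ → β) : (mkS m f).length = m := by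
  simp [mkS]

/-- [folklore] -/
private theorem coeff_mkS (m : ℕ) (f : ℕ → β) (k : ℕ) :
    coeff (mkS m f) k = if k < m then f k else 0 := by
  unfold coeff mkS
  split_ifs with h
  · rw [List.getD_eq_getElem _ _ (by simpa using h)]
    simp
  · exact List.getD_eq_default _ _ (by simpa using Nat.le_of_not_lt h)

/-- **Recursive generation** of a coefficient list: `recList step m = [c₀, …, c_{m−1}]` with
`c_k = step [c₀, …, c_{k−1}] k` — each Taylor coefficient is computed from the stored lower ones
(Moore's "derived program"). [cite: Moore1979, §3.4 procedure steps 1–4] -/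
def recList (step : List β → ℕ → β) : ℕ → List β
  | 0 => []
  | m + 1 => recList step m ++ [step (recList step m) m]

omit [Zero β] in
/-- [folklore] -/
private theorem length_recList (step : List β → ℕ → β) (m : ℕ) :
    (recList step m).length = m := by
  induction m with
  | zero => rfl
  | succ m ih => simp [recList, ih]

/-- The entries of `recList`: `c_j = step (recList step j) j`. [folklore] -/
private theorem coeff_recList (step : List β → ℕ → β) (m j : ℕ) :
    coeff (recList step m) j = if j < m then step (recList step j) j else 0 := by
  induction m with
  | zero => simp [coeff, recList]
  | succ m ih =>
    show coeff (recList step m ++ [step (recList step m) m]) j = _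
    by_cases hj : j < m
    · rw [coeff, List.getD_append _ _ _ _ (by simpa [length_recList] using hj), ← coeff, ih,
        if_pos hj, if_pos (Nat.lt_succ_of_lt hj)]
    · by_cases hjm : j = m
      · subst hjm
        rw [coeff, List.getD_append_right _ _ _ _ (by simp [length_recList]), length_recList,
          Nat.sub_self, if_pos (Nat.lt_succ_self j)]
        rfl
      · rw [coeff, List.getD_append_right _ _ _ _ (by simp [length_recList]; omega),
          length_recList, if_neg (by omega)]
        obtain ⟨d, hd⟩ : ∃ d, j - m = d + 1 := ⟨j - m - 1, by omega⟩
        rw [hd]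
        rfl

/-- Induction principle along `recList`: a property of the `k`-th coefficient that follows from
the property of all lower ones propagates to the whole list. [folklore] -/
private theorem recList_induction {M : ℕ → β → Prop} (step : List β → ℕ → β) {m : ℕ}
    (h : ∀ k < m, (∀ j < k, M j (coeff (recList step k) j)) → M k (step (recList step k) k)) :
    ∀ j < m, M j (coeff (recList step m) j) := by
  suffices H : ∀ n ≤ m, ∀ j < n, M j (coeff (recList step n) j) from H m le_rfl
  intro n
  induction n with
  | zero => intro _ j hj; exact absurd hj (Nat.not_lt_zero j)
  | succ n ih =>
    intro hn j hj
    have hPn := ih (Nat.le_of_succ_le hn)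
    rw [coeff_recList, if_pos hj]
    rcases Nat.lt_succ_iff_lt_or_eq.mp hj with hlt | rfl
    · have := hPn j hlt
      rwa [coeff_recList, if_pos hlt] at this
    · exact h j (Nat.lt_of_succ_le hn) hPn

end Lists

/-- [folklore] -/
private theorem coeff_map_fst (W : List (Iv × Iv)) (k : ℕ) :
    coeff (W.map Prod.fst) k = (coeff W k).1 := by
  show (W.map Prod.fst).getD k (Prod.fst (0 : Iv × Iv)) = (W.getD k 0).1
  exact List.getD_map (f := Prod.fst) ..

/-- [folklore] -/
private theorem coeff_map_snd (W : List (Iv × Iv)) (k : ℕ) :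
    coeff (W.map Prod.snd) k = (coeff W k).2 := by
  show (W.map Prod.snd).getD k (Prod.snd (0 : Iv × Iv)) = (W.getD k 0).2
  exact List.getD_map (f := Prod.snd) ..

/-! ### Coefficientwise enclosure of a real sequence -/

/-- `SeqMem n a A`: the interval list `A = [A₀, …, A_{n−1}]` has length `n` and encloses the real
sequence `a` coefficientwise, `a k ∈ A_k` for `k < n` — an "interval Taylor series" of order
`n − 1` (the coefficient part of (3.16)). [cite: Moore1979, §3.4 eq. (3.16)] -/
def SeqMem (n : ℕ) (a : ℕ → ℝ) (A : List Iv) : Prop :=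
  A.length = n ∧ ∀ k, k < n → a k ∈ (coeff A k).ratCast ℝ

/-- Reading a coefficient: `a k ∈ A_k` for `k` below the order.
[cite: Moore1979, §3.4 eq. (3.16)] -/
theorem SeqMem.coeff_mem {n : ℕ} {a : ℕ → ℝ} {A : List Iv} (h : SeqMem n a A) {k : ℕ}
    (hk : k < n) : a k ∈ (coeff A k).ratCast ℝ :=
  h.2 k hk

/-- The enclosed sequence may be replaced by an equal one. [cite: Moore1979, §3.4 eq. (3.16)] -/
theorem SeqMem.congr {n : ℕ} {a b : ℕ → ℝ} {A : List Iv} (h : SeqMem n a A)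
    (hab : ∀ k, a k = b k) : SeqMem n b A :=
  ⟨h.1, fun k hk => hab k ▸ h.2 k hk⟩

/-- The empty interval Taylor series (order `−1`). [cite: Moore1979, §3.4 eq. (3.16)] -/
theorem seqMem_zero (a : ℕ → ℝ) : SeqMem 0 a [] := ⟨rfl, fun k hk => absurd hk (Nat.not_lt_zero k)⟩

/-- **Appending the next coefficient** (how `(x)_k = (1/k)((x)_1)_{k−1}` extends the series of
the solution by one order). [cite: Moore1979, §3.4 eq. (3.17)] -/
theorem seqMem_snoc {n : ℕ} {a : ℕ → ℝ} {A : List Iv} {I : Iv} (h : SeqMem n a A)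
    (hn : a n ∈ I.ratCast ℝ) : SeqMem (n + 1) a (A ++ [I]) := by
  refine ⟨by simp [h.1], fun k hk => ?_⟩
  rcases Nat.lt_succ_iff_lt_or_eq.mp hk with hlt | rfl
  · rw [coeff, List.getD_append _ _ _ _ (by rw [h.1]; exact hlt)]
    exact h.2 k hlt
  · rw [coeff, List.getD_append_right _ _ _ _ (by rw [h.1]), h.1, Nat.sub_self]
    exact hn

/-- [folklore] -/
private theorem seqMem_mkS {a : ℕ → ℝ} {m : ℕ} {f : ℕ → Iv} (h : ∀ k < m, a k ∈ (f k).ratCast ℝ) :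
    SeqMem m a (mkS m f) := by
  refine ⟨length_mkS m f, fun k hk => ?_⟩
  rw [coeff_mkS, if_pos hk]
  exact h k hk

/-- Soundness of recursive generation: if each step encloses the `k`-th coefficient whenever the
stored lower coefficients are enclosed, the generated list encloses the sequence. [folklore] -/
private theorem seqMem_recList {a : ℕ → ℝ} (step : List Iv → ℕ → Iv) {m : ℕ}
    (h : ∀ k < m, SeqMem k a (recList step k) → a k ∈ (step (recList step k) k).ratCast ℝ) :
    SeqMem m a (recList step m) := by
  refine ⟨length_recList step m, fun j hj => ?_⟩
  exact recList_induction (M := fun j I => a j ∈ I.ratCast ℝ) step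
    (fun k hk hprev => h k hk ⟨length_recList step k, hprev⟩) j hj

/-! ### Interval building blocks -/

/-- Scaling of an interval by a rational constant, `q · I = [q, q] · I`.
[cite: Moore1979, §3.4, remark after (3.18)] -/
def scale (q : ℚ) (I : Iv) : Iv := (NonemptyInterval.pure q).mooreMul I

/-- Inclusion property of `scale`. [cite: Moore1966, Theorem 3.1] -/
theorem mem_scale (q : ℚ) {I : Iv} {x : ℝ} (hx : x ∈ I.ratCast ℝ) :
    (q : ℝ) * x ∈ (scale q I).ratCast ℝ := by
  rw [scale, ratCast_mooreMul, ratCast_pure]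
  exact mul_mem_mooreMul (mem_pure_self _) hx

/-- Structurally recursive interval sum `∑_{j<n} f j` (kernel-friendly).
[cite: Moore1966, Theorem 3.1] -/
def isum (f : ℕ → Iv) : ℕ → Iv
  | 0 => 0
  | n + 1 => isum f n + f n

/-- [folklore] -/
private theorem add_mem_add {I J : Iv} {x y : ℝ} (hx : x ∈ I.ratCast ℝ) (hy : y ∈ J.ratCast ℝ) :
    x + y ∈ (I + J).ratCast ℝ := by
  rw [QMvPoly.ratCast_add]; exact QMvPoly.add_mem_add_of_mem hx hy

/-- Inclusion property of the interval sum. [cite: Moore1966, Theorem 3.1] -/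
theorem sum_mem_isum {f : ℕ → Iv} {a : ℕ → ℝ} {n : ℕ} (h : ∀ j < n, a j ∈ (f j).ratCast ℝ) :
    ∑ j ∈ range n, a j ∈ (isum f n).ratCast ℝ := by
  induction n with
  | zero =>
    rw [Finset.sum_range_zero, isum, QMvPoly.ratCast_zero]
    exact mem_pure_self (0 : ℝ)
  | succ n ih =>
    rw [Finset.sum_range_succ, isum]
    exact add_mem_add (ih fun j hj => h j (Nat.lt_succ_of_lt hj)) (h n (Nat.lt_succ_self n))

/-- [folklore] -/
private theorem sub_mem_sub {I J : Iv} {x y : ℝ} (hx : x ∈ I.ratCast ℝ) (hy : y ∈ J.ratCast ℝ) :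
    x - y ∈ (I - J).ratCast ℝ := by
  rw [mem_ratCast_iff] at hx hy ⊢
  simp only [NonemptyInterval.fst_sub, NonemptyInterval.snd_sub, Rat.cast_sub]
  constructor <;> linarith [hx.1, hx.2, hy.1, hy.2]

/-- [folklore] -/
private theorem neg_mem_neg {I : Iv} {x : ℝ} (hx : x ∈ I.ratCast ℝ) : -x ∈ (-I).ratCast ℝ := by
  rw [mem_ratCast_iff] at hx ⊢
  simp only [NonemptyInterval.fst_neg, NonemptyInterval.snd_neg, Rat.cast_neg]
  constructor <;> linarith [hx.1, hx.2]

/-- [folklore] -/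
private theorem mul_mem_mul {I J : Iv} {x y : ℝ} (hx : x ∈ I.ratCast ℝ) (hy : y ∈ J.ratCast ℝ) :
    x * y ∈ (I.mooreMul J).ratCast ℝ := by
  rw [ratCast_mooreMul]; exact mul_mem_mooreMul hx hy

/-- An interval on which `invI?` succeeds does not contain `0`. [cite: Moore1966, Ch. 3] -/
theorem ne_zero_of_invI? {I J : Iv} (hJ : I.invI? = some J) {x : ℝ} (hx : x ∈ I.ratCast ℝ) :
    x ≠ 0 := by
  rw [mem_ratCast_iff] at hx
  unfold NonemptyInterval.invI? at hJ
  split_ifs at hJ with ha hb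
  · have : (0 : ℝ) < I.fst := by exact_mod_cast ha
    exact (this.trans_le hx.1).ne'
  · have : (I.snd : ℝ) < 0 := by exact_mod_cast hb
    exact (hx.2.trans_lt this).ne

/-- Solving `v · w = c` for `w` in interval arithmetic: `w ∈ V⁻¹ · C`.
[cite: Moore1979, §3.4 eq. (3.18)] -/
theorem solve_mem {v w c : ℝ} {Vi C : Iv} (hv : v ≠ 0) (hVi : v⁻¹ ∈ Vi.ratCast ℝ)
    (hc : c ∈ C.ratCast ℝ) (h : v * w = c) : w ∈ (Vi.mooreMul C).ratCast ℝ := by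
  have hw : w = v⁻¹ * c := by rw [← h, ← mul_assoc, inv_mul_cancel₀ hv, one_mul]
  rw [hw]
  exact mul_mem_mul hVi hc

/-! ### Seeds: partial interval extensions of the elementary functions -/

/-- `SeedSound f F`: the partial interval map `F` (it may give up, `none`) is a sound interval
extension of `f` wherever it answers. [cite: Moore1966, Theorem 3.1] -/
def SeedSound (f : ℝ → ℝ) (F : Iv → Option Iv) : Prop :=
  ∀ ⦃I J : Iv⦄ ⦃x : ℝ⦄, F I = some J → x ∈ I.ratCast ℝ → f x ∈ J.ratCast ℝ

/-- `SeedSoundOn p f F`: as `SeedSound`, and an answer also certifies the side condition `p` on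
the whole input interval (e.g. positivity for `log`, `sqrt`). [cite: Moore1966, Theorem 3.1] -/
def SeedSoundOn (p : ℝ → Prop) (f : ℝ → ℝ) (F : Iv → Option Iv) : Prop :=
  ∀ ⦃I J : Iv⦄ ⦃x : ℝ⦄, F I = some J → x ∈ I.ratCast ℝ → p x ∧ f x ∈ J.ratCast ℝ

/-- `SeedSound₂ f g F`: a joint partial interval extension of the pair `(f, g)` (used for
`(sin, cos)`). [cite: Moore1966, Theorem 3.1] -/
def SeedSound₂ (f g : ℝ → ℝ) (F : Iv → Option (Iv × Iv)) : Prop :=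
  ∀ ⦃I : Iv⦄ ⦃P : Iv × Iv⦄ ⦃x : ℝ⦄, F I = some P → x ∈ I.ratCast ℝ →
    f x ∈ P.1.ratCast ℝ ∧ g x ∈ P.2.ratCast ℝ

/-! ### The arithmetic rules (3.18) -/

/-- `(u + v)_k = (u)_k + (v)_k`. [cite: Moore1979, §3.4 eq. (3.18)] -/
def addS (U V : List Iv) : List Iv := mkS U.length fun k => coeff U k + coeff V k

/-- Inclusion property of `addS`. [cite: Moore1979, §3.4 eq. (3.18)] -/
theorem seqMem_addS {n : ℕ} {u v : ℕ → ℝ} {U V : List Iv} (hu : SeqMem n u U)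
    (hv : SeqMem n v V) : SeqMem n (fun k => u k + v k) (addS U V) := by
  unfold addS; rw [hu.1]
  exact seqMem_mkS fun k hk => add_mem_add (hu.2 k hk) (hv.2 k hk)

/-- `(u − v)_k = (u)_k − (v)_k`. [cite: Moore1979, §3.4 eq. (3.18)] -/
def subS (U V : List Iv) : List Iv := mkS U.length fun k => coeff U k - coeff V k

/-- Inclusion property of `subS`. [cite: Moore1979, §3.4 eq. (3.18)] -/
theorem seqMem_subS {n : ℕ} {u v : ℕ → ℝ} {U V : List Iv} (hu : SeqMem n u U)
    (hv : SeqMem n v V) : SeqMem n (fun k => u k - v k) (subS U V) := by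
  unfold subS; rw [hu.1]
  exact seqMem_mkS fun k hk => sub_mem_sub (hu.2 k hk) (hv.2 k hk)

/-- `(−u)_k = −(u)_k`. [cite: Moore1979, §3.4 eq. (3.18)] -/
def negS (U : List Iv) : List Iv := mkS U.length fun k => -coeff U k

/-- Inclusion property of `negS`. [cite: Moore1979, §3.4 eq. (3.18)] -/
theorem seqMem_negS {n : ℕ} {u : ℕ → ℝ} {U : List Iv} (hu : SeqMem n u U) :
    SeqMem n (fun k => -u k) (negS U) := by
  unfold negS; rw [hu.1]
  exact seqMem_mkS fun k hk => neg_mem_neg (hu.2 k hk)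

/-- `(q u)_k = q (u)_k` for a constant `q`. [cite: Moore1979, §3.4, remark after (3.18)] -/
def smulS (q : ℚ) (U : List Iv) : List Iv := mkS U.length fun k => scale q (coeff U k)

/-- Inclusion property of `smulS`. [cite: Moore1979, §3.4, remark after (3.18)] -/
theorem seqMem_smulS (q : ℚ) {n : ℕ} {u : ℕ → ℝ} {U : List Iv} (hu : SeqMem n u U) :
    SeqMem n (fun k => (q : ℝ) * u k) (smulS q U) := by
  unfold smulS; rw [hu.1]
  exact seqMem_mkS fun k hk => mem_scale q (hu.2 k hk)

/-- The constant `q` to order `m − 1`: `(q)_0 = q`, `(q)_j = 0` for `j ≥ 1`.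
[cite: Moore1979, §3.4, remark after (3.18)] -/
def constS (q : ℚ) (m : ℕ) : List Iv :=
  mkS m fun k => if k = 0 then NonemptyInterval.pure q else 0

/-- Inclusion property of `constS`. [cite: Moore1979, §3.4, remark after (3.18)] -/
theorem seqMem_constS {c : ℕ → ℝ} (q : ℚ) (m : ℕ) (h0 : c 0 = q) (hs : ∀ k, c (k + 1) = 0) :
    SeqMem m c (constS q m) := by
  refine seqMem_mkS fun k _ => ?_
  cases k with
  | zero => rw [if_pos rfl, h0, ratCast_pure]; exact mem_pure_self _
  | succ k =>
    rw [if_neg (Nat.succ_ne_zero k), hs, QMvPoly.ratCast_zero]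
    exact mem_pure_self (0 : ℝ)

/-- `(uv)_k = ∑_{j ≤ k} (u)_j (v)_{k−j}` (Cauchy product), each coefficient rounded outward to
`prec` binary digits. [cite: Moore1979, §3.4 eq. (3.18)] -/
def mulS (prec : ℕ) (U V : List Iv) : List Iv :=
  mkS U.length fun k =>
    (isum (fun i => (coeff U i).mooreMul (coeff V (k - i))) (k + 1)).roundOut prec

/-- Inclusion property of `mulS` (Moore's product rule). [cite: Moore1979, §3.4 eq. (3.18)] -/
theorem seqMem_mulS (prec : ℕ) {n : ℕ} {u v w : ℕ → ℝ} {U V : List Iv} (hu : SeqMem n u U)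
    (hv : SeqMem n v V) (hw : ∀ k, w k = ∑ p ∈ antidiagonal k, u p.1 * v p.2) :
    SeqMem n w (mulS prec U V) := by
  unfold mulS; rw [hu.1]
  refine seqMem_mkS fun k hk => ?_
  rw [hw k, Finset.Nat.sum_antidiagonal_eq_sum_range_succ (fun i j => u i * v j)]
  exact mem_roundOut prec
    (sum_mem_isum fun i hi => mul_mem_mul (hu.2 i (by omega)) (hv.2 (k - i) (by omega)))

/-! ### The chain-rule recurrence and the elementary functions (3.19) -/

/-- The **chain-rule coefficient** `(1/k) ∑_{i=1}^{k} i (u)_i (f)_{k−i}` — the common right-hand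
side of Moore's rules for `eᵘ` (`f = eᵘ`), `sin u` (`f = cos u`), `cos u` (`f = −sin u`),
`arctan u` (`f = 1/(1+u²)`): if `e' = f · u'` then `k (e)_k = ∑_{i+j=k} i (u)_i (f)_j`.
[cite: Moore1979, §3.4 eq. (3.19) and the chain-rule remark] -/
def chainCoeff (U F : List Iv) (k : ℕ) : Iv :=
  scale (1 / k) (isum (fun i => scale ((i + 1 : ℕ) : ℚ)
    ((coeff U (i + 1)).mooreMul (coeff F (k - (i + 1))))) k)

/-- Inclusion property of the chain-rule coefficient: if `k e_k = ∑_{i+j=k} i u_i f_j` (`k ≥ 1`)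
and `u`, `f` are enclosed up to order `k` resp. below `k`, then `e_k ∈ chainCoeff U F k`.
[cite: Moore1979, §3.4 eq. (3.19) and the chain-rule remark] -/
theorem mem_chainCoeff {n : ℕ} {u f e : ℕ → ℝ} {U F : List Iv} {k : ℕ} (hk : 0 < k) (hkn : k < n)
    (hu : SeqMem n u U) (hf : ∀ j < k, f j ∈ (coeff F j).ratCast ℝ)
    (hrec : (k : ℝ) * e k = ∑ p ∈ antidiagonal k, (p.1 : ℝ) * (u p.1 * f p.2)) :
    e k ∈ (chainCoeff U F k).ratCast ℝ := by
  rw [Finset.Nat.sum_antidiagonal_eq_sum_range_succ (fun i j => (i : ℝ) * (u i * f j)),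
    Finset.sum_range_succ'] at hrec
  simp only [Nat.cast_zero, zero_mul, add_zero] at hrec
  have hk' : (k : ℝ) ≠ 0 := by exact_mod_cast hk.ne'
  have he : e k = (((1 : ℚ) / k : ℚ) : ℝ) *
      ∑ i ∈ range k, (((i + 1 : ℕ) : ℚ) : ℝ) * (u (i + 1) * f (k - (i + 1))) := by
    simp only [Rat.cast_div, Rat.cast_one, Rat.cast_natCast]
    rw [← hrec, one_div, ← mul_assoc, inv_mul_cancel₀ hk', one_mul]
  rw [he]
  exact mem_scale _ (sum_mem_isum fun i hi =>
    mem_scale _ (mul_mem_mul (hu.2 (i + 1) (by omega)) (hf (k - (i + 1)) (by omega))))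

/-- One step of the exponential recurrence: `(eᵘ)_0 = E₀` (seed), `(eᵘ)_k = chainCoeff U E k`.
[cite: Moore1979, §3.4 eq. (3.19)] -/
def expStep (U : List Iv) (E0 : Iv) (prec : ℕ) (L : List Iv) (k : ℕ) : Iv :=
  if k = 0 then E0 else (chainCoeff U L k).roundOut prec

/-- **Moore's recurrence for `eᵘ`** in interval arithmetic:
`(eᵘ)_k = ∑_{j<k} (1 − j/k) (eᵘ)_j (u)_{k−j}`, seeded by an interval enclosure `EXP` of `exp`
at order `0`; `none` if the seed gives up. [cite: Moore1979, §3.4 eq. (3.19)] -/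
def expS (EXP : Iv → Option Iv) (prec : ℕ) (U : List Iv) : Option (List Iv) :=
  (EXP (coeff U 0)).map fun E0 => recList (expStep U E0 prec) U.length

/-- Inclusion property of `expS`: if `u ∈ U`, `e_0 = exp u_0` and `k e_k = ∑_{i+j=k} i u_i e_j`
for all `k`, then `e ∈ expS EXP prec U`. [cite: Moore1979, §3.4 eq. (3.19)] -/
theorem seqMem_expS {EXP : Iv → Option Iv} (hEXP : SeedSound Real.exp EXP) (prec : ℕ) {n : ℕ}
    {u e : ℕ → ℝ} {U E : List Iv} (hu : SeqMem n u U) (hE : expS EXP prec U = some E)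
    (h0 : e 0 = Real.exp (u 0))
    (hrec : ∀ k : ℕ, (k : ℝ) * e k = ∑ p ∈ antidiagonal k, (p.1 : ℝ) * (u p.1 * e p.2)) :
    SeqMem n e E := by
  unfold expS at hE
  rw [hu.1] at hE
  cases hE0 : EXP (coeff U 0) with
  | none => rw [hE0] at hE; simp at hE
  | some E0 =>
    simp only [hE0, Option.map_some, Option.some.injEq] at hE
    subst hE
    refine seqMem_recList _ fun k hk hprev => ?_
    unfold expStep
    split_ifs with hk0
    · subst hk0
      rw [h0]
      exact hEXP hE0 (hu.2 0 hk)
    · exact mem_roundOut prec (mem_chainCoeff (Nat.pos_of_ne_zero hk0) hk hu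
        (fun j hj => hprev.2 j hj) (hrec k))

/-- One step of the joint sine/cosine recurrence: `((sin u)_k, (cos u)_k)` from the stored pairs.
[cite: Moore1979, §3.4 eq. (3.19)] -/
def sinCosStep (U : List Iv) (P : Iv × Iv) (prec : ℕ) (L : List (Iv × Iv)) (k : ℕ) : Iv × Iv :=
  if k = 0 then P else
    ((chainCoeff U (L.map Prod.snd) k).roundOut prec,
      (-chainCoeff U (L.map Prod.fst) k).roundOut prec)

/-- **Moore's recurrences for `sin u` and `cos u`** (computed jointly):
`(sin u)_k = (1/k) ∑_{j<k} (j+1) (cos u)_{k−1−j} (u)_{j+1}`,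
`(cos u)_k = −(1/k) ∑_{j<k} (j+1) (sin u)_{k−1−j} (u)_{j+1}`, seeded by a joint enclosure
`CS` of `(sin, cos)` at order `0`. [cite: Moore1979, §3.4 eq. (3.19)] -/
def sinCosS (CS : Iv → Option (Iv × Iv)) (prec : ℕ) (U : List Iv) : Option (List (Iv × Iv)) :=
  (CS (coeff U 0)).map fun P => recList (sinCosStep U P prec) U.length

/-- The sine components of `sinCosS`. [cite: Moore1979, §3.4 eq. (3.19)] -/
def sinS (CS : Iv → Option (Iv × Iv)) (prec : ℕ) (U : List Iv) : Option (List Iv) :=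
  (sinCosS CS prec U).map (List.map Prod.fst)

/-- The cosine components of `sinCosS`. [cite: Moore1979, §3.4 eq. (3.19)] -/
def cosS (CS : Iv → Option (Iv × Iv)) (prec : ℕ) (U : List Iv) : Option (List Iv) :=
  (sinCosS CS prec U).map (List.map Prod.snd)

/-- Inclusion property of `sinCosS`: if `u ∈ U`, `s_0 = sin u_0`, `c_0 = cos u_0`,
`k s_k = ∑_{i+j=k} i u_i c_j` and `k c_k = −∑_{i+j=k} i u_i s_j`, then `s` and `c` are enclosed by
the two components. [cite: Moore1979, §3.4 eq. (3.19)] -/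
theorem seqMem_sinCosS {CS : Iv → Option (Iv × Iv)} (hCS : SeedSound₂ Real.sin Real.cos CS)
    (prec : ℕ) {n : ℕ} {u s c : ℕ → ℝ} {U : List Iv} {W : List (Iv × Iv)} (hu : SeqMem n u U)
    (hW : sinCosS CS prec U = some W) (hs0 : s 0 = Real.sin (u 0)) (hc0 : c 0 = Real.cos (u 0))
    (hs : ∀ k : ℕ, (k : ℝ) * s k = ∑ p ∈ antidiagonal k, (p.1 : ℝ) * (u p.1 * c p.2))
    (hc : ∀ k : ℕ, (k : ℝ) * c k = -∑ p ∈ antidiagonal k, (p.1 : ℝ) * (u p.1 * s p.2)) :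
    SeqMem n s (W.map Prod.fst) ∧ SeqMem n c (W.map Prod.snd) := by
  unfold sinCosS at hW
  rw [hu.1] at hW
  cases hP : CS (coeff U 0) with
  | none => rw [hP] at hW; simp at hW
  | some P =>
    simp only [hP, Option.map_some, Option.some.injEq] at hW
    subst hW
    have key : ∀ j < n, s j ∈ (coeff (recList (sinCosStep U P prec) n) j).1.ratCast ℝ ∧
        c j ∈ (coeff (recList (sinCosStep U P prec) n) j).2.ratCast ℝ := by
      refine recList_induction
        (M := fun j (Q : Iv × Iv) => s j ∈ Q.1.ratCast ℝ ∧ c j ∈ Q.2.ratCast ℝ) _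
        fun k hk hprev => ?_
      unfold sinCosStep
      split_ifs with hk0
      · subst hk0
        rw [hs0, hc0]
        exact hCS hP (hu.2 0 hk)
      · have hk1 := Nat.pos_of_ne_zero hk0
        refine ⟨mem_roundOut prec (mem_chainCoeff hk1 hk hu (fun j hj => ?_) (hs k)),
          mem_roundOut prec (neg_neg (c k) ▸ neg_mem_neg
            (mem_chainCoeff (f := s) (e := fun k => -c k) hk1 hk hu (fun j hj => ?_) ?_))⟩
        · rw [coeff_map_snd]; exact (hprev j hj).2
        · rw [coeff_map_fst]; exact (hprev j hj).1
        · rw [mul_neg, hc k, neg_neg]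
    refine ⟨⟨by rw [List.length_map, length_recList], fun j hj => ?_⟩,
      ⟨by rw [List.length_map, length_recList], fun j hj => ?_⟩⟩
    · rw [coeff_map_fst]; exact (key j hj).1
    · rw [coeff_map_snd]; exact (key j hj).2

/-- One step of the logarithm recurrence (`Ui ∋ 1/(u)_0`, `L0 ∋ log (u)_0`).
[cite: Moore1979, §3.4 eq. (3.19)] -/
def logStep (U : List Iv) (L0 Ui : Iv) (prec : ℕ) (L : List Iv) : ℕ → Iv
  | 0 => L0
  | n + 1 => (Ui.mooreMul (coeff U (n + 1) - scale (1 / (n + 1 : ℕ))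
      (isum (fun i => scale ((i + 1 : ℕ) : ℚ) ((coeff L (i + 1)).mooreMul (coeff U (n - i)))) n)))
        |>.roundOut prec

/-- **Moore's recurrence for `log u`** in interval arithmetic:
`(log u)_k = (1/u) ( (u)_k − ∑_{0<j<k} (1 − j/k) (u)_j (log u)_{k−j} )`, seeded by an enclosure
`LOG` of `log` at order `0` and the interval reciprocal of `(u)_0`; `none` if either gives up.
[cite: Moore1979, §3.4 eq. (3.19)] -/
def logS (LOG : Iv → Option Iv) (prec : ℕ) (U : List Iv) : Option (List Iv) :=
  (LOG (coeff U 0)).bind fun L0 =>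
    ((coeff U 0).invI?).map fun Ui => recList (logStep U L0 Ui prec) U.length

/-- Inclusion property of `logS`: if `u ∈ U`, `l_0 = log u_0` and
`u_0 ((n+1) l_{n+1}) = (n+1) u_{n+1} − ∑_{i+j=n} i l_i u_{j+1}` for all `n`, then
`l ∈ logS LOG prec U`.
[cite: Moore1979, §3.4 eq. (3.19)] -/
theorem seqMem_logS {LOG : Iv → Option Iv} (hLOG : SeedSoundOn (fun x => 0 < x) Real.log LOG)
    (prec : ℕ) {m : ℕ} {u l : ℕ → ℝ} {U L : List Iv} (hu : SeqMem m u U)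
    (hL : logS LOG prec U = some L) (h0 : l 0 = Real.log (u 0))
    (hrec : ∀ n : ℕ, u 0 * (((n : ℝ) + 1) * l (n + 1)) =
      ((n : ℝ) + 1) * u (n + 1) - ∑ p ∈ antidiagonal n, (p.1 : ℝ) * (l p.1 * u (p.2 + 1))) :
    SeqMem m l L := by
  unfold logS at hL
  rw [hu.1] at hL
  cases hL0 : LOG (coeff U 0) with
  | none => rw [hL0] at hL; simp at hL
  | some L0 =>
    cases hUi : (coeff U 0).invI? with
    | none => rw [hL0, hUi] at hL; simp at hL
    | some Ui =>
      simp only [hL0, hUi, Option.bind_some, Option.map_some, Option.some.injEq] at hL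
      subst hL
      refine seqMem_recList _ fun k hk hprev => ?_
      have hu0 := hu.2 0 (lt_of_le_of_lt (Nat.zero_le k) hk)
      cases k with
      | zero =>
        show l 0 ∈ L0.ratCast ℝ
        rw [h0]
        exact (hLOG hL0 hu0).2
      | succ n =>
        simp only [logStep]
        have hn1 : ((n : ℝ) + 1) ≠ 0 := by positivity
        have hrec' := hrec n
        rw [Finset.Nat.sum_antidiagonal_eq_sum_range_succ (fun i j => (i : ℝ) * (l i * u (j + 1))),
          Finset.sum_range_succ'] at hrec'
        simp only [Nat.cast_zero, zero_mul, add_zero] at hrec'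
        have hsum : ∑ i ∈ range n, (((i + 1 : ℕ) : ℕ) : ℝ) * (l (i + 1) * u (n - (i + 1) + 1)) =
            ∑ i ∈ range n, (((i + 1 : ℕ) : ℚ) : ℝ) * (l (i + 1) * u (n - i)) := by
          refine Finset.sum_congr rfl fun i hi => ?_
          rw [Finset.mem_range] at hi
          rw [Rat.cast_natCast, show n - (i + 1) + 1 = n - i by omega]
        rw [hsum] at hrec'
        set S := ∑ i ∈ range n, (((i + 1 : ℕ) : ℚ) : ℝ) * (l (i + 1) * u (n - i)) with hS
        have hq : (((1 : ℚ) / (n + 1 : ℕ) : ℚ) : ℝ) = 1 / ((n : ℝ) + 1) := by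
          simp only [Rat.cast_div, Rat.cast_one, Rat.cast_add, Rat.cast_natCast, Nat.cast_add,
            Nat.cast_one]
        have key : u 0 * l (n + 1) = u (n + 1) - (((1 : ℚ) / (n + 1 : ℕ) : ℚ) : ℝ) * S := by
          rw [hq]
          apply mul_left_cancel₀ hn1
          rw [mul_sub, ← mul_assoc _ (1 / _) S, mul_one_div_cancel hn1, one_mul, ← hrec']
          ring
        exact mem_roundOut prec (solve_mem (ne_zero_of_invI? hUi hu0) (inv_mem_of_invI? hu0 hUi)
          (sub_mem_sub (hu.2 (n + 1) hk) (mem_scale _ (sum_mem_isum fun i hi =>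
            mem_scale _ (mul_mem_mul (hprev.2 (i + 1) (by omega))
              (hu.2 (n - i) (by omega)))))) key)

/-- One step of the reciprocal recurrence (`Vi ∋ 1/(v)_0`). [cite: Moore1979, §3.4 eq. (3.18)] -/
def invStep (V : List Iv) (Vi : Iv) (prec : ℕ) (L : List Iv) : ℕ → Iv
  | 0 => Vi
  | n + 1 => (-(Vi.mooreMul
      (isum (fun i => (coeff V (i + 1)).mooreMul (coeff L (n - i))) (n + 1)))).roundOut prec

/-- **The reciprocal `1/v`** in interval Taylor arithmetic:
`(1/v)_k = −(1/v) ∑_{j=1}^{k} (v)_j (1/v)_{k−j}` (the quotient rule with `u = 1`); `none` if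
`0 ∈ (v)_0`. [cite: Moore1979, §3.4 eq. (3.18)] -/
def invS (prec : ℕ) (V : List Iv) : Option (List Iv) :=
  ((coeff V 0).invI?).map fun Vi => recList (invStep V Vi prec) V.length

/-- Inclusion property of `invS`: if `v ∈ V`, `v_0 w_0 = 1` and
`v_0 w_{n+1} = −∑_{i+j=n} v_{i+1} w_j` for all `n`, then `w ∈ invS prec V`.
[cite: Moore1979, §3.4 eq. (3.18)] -/
theorem seqMem_invS (prec : ℕ) {m : ℕ} {v w : ℕ → ℝ} {V W : List Iv} (hv : SeqMem m v V)
    (hW : invS prec V = some W) (h0 : v 0 * w 0 = 1)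
    (hrec : ∀ n : ℕ, v 0 * w (n + 1) = -∑ p ∈ antidiagonal n, v (p.1 + 1) * w p.2) :
    SeqMem m w W := by
  unfold invS at hW
  rw [hv.1] at hW
  cases hVi : (coeff V 0).invI? with
  | none => rw [hVi] at hW; simp at hW
  | some Vi =>
    simp only [hVi, Option.map_some, Option.some.injEq] at hW
    subst hW
    refine seqMem_recList _ fun k hk hprev => ?_
    have hv0 := hv.2 0 (lt_of_le_of_lt (Nat.zero_le k) hk)
    cases k with
    | zero =>
      show w 0 ∈ Vi.ratCast ℝ
      rw [(inv_eq_of_mul_eq_one_right h0).symm]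
      exact inv_mem_of_invI? hv0 hVi
    | succ n =>
      simp only [invStep]
      have hrec' := hrec n
      rw [Finset.Nat.sum_antidiagonal_eq_sum_range_succ (fun i j => v (i + 1) * w j)] at hrec'
      have key : v 0 * -w (n + 1) = ∑ i ∈ range (n + 1), v (i + 1) * w (n - i) := by
        rw [mul_neg, hrec', neg_neg]
      have hmem := solve_mem (ne_zero_of_invI? hVi hv0) (inv_mem_of_invI? hv0 hVi)
        (sum_mem_isum fun i hi => mul_mem_mul (hv.2 (i + 1) (by omega))
          (hprev.2 (n - i) (by omega))) key
      rw [← neg_neg (w (n + 1))]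
      exact mem_roundOut prec (neg_mem_neg hmem)

/-- One step of the quotient recurrence (`Vi ∋ 1/(v)_0`). [cite: Moore1979, §3.4 eq. (3.18)] -/
def divStep (U V : List Iv) (Vi : Iv) (prec : ℕ) (L : List Iv) : ℕ → Iv
  | 0 => (Vi.mooreMul (coeff U 0)).roundOut prec
  | n + 1 => (Vi.mooreMul (coeff U (n + 1) -
      isum (fun i => (coeff V (i + 1)).mooreMul (coeff L (n - i))) (n + 1))).roundOut prec

/-- **Moore's quotient rule** in interval Taylor arithmetic:
`(u/v)_k = (1/v) { (u)_k − ∑_{j=1}^{k} (v)_j (u/v)_{k−j} }`; `none` if `0 ∈ (v)_0`.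
[cite: Moore1979, §3.4 eq. (3.18)] -/
def divS (prec : ℕ) (U V : List Iv) : Option (List Iv) :=
  ((coeff V 0).invI?).map fun Vi => recList (divStep U V Vi prec) U.length

/-- Inclusion property of `divS`: if `u ∈ U`, `v ∈ V`, `v_0 w_0 = u_0` and
`v_0 w_{n+1} = u_{n+1} − ∑_{i+j=n} v_{i+1} w_j` for all `n`, then `w ∈ divS prec U V`.
[cite: Moore1979, §3.4 eq. (3.18)] -/
theorem seqMem_divS (prec : ℕ) {m : ℕ} {u v w : ℕ → ℝ} {U V W : List Iv} (hu : SeqMem m u U)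
    (hv : SeqMem m v V) (hW : divS prec U V = some W) (h0 : v 0 * w 0 = u 0)
    (hrec : ∀ n : ℕ, v 0 * w (n + 1) =
      u (n + 1) - ∑ p ∈ antidiagonal n, v (p.1 + 1) * w p.2) :
    SeqMem m w W := by
  unfold divS at hW
  rw [hu.1] at hW
  cases hVi : (coeff V 0).invI? with
  | none => rw [hVi] at hW; simp at hW
  | some Vi =>
    simp only [hVi, Option.map_some, Option.some.injEq] at hW
    subst hW
    refine seqMem_recList _ fun k hk hprev => ?_
    have hv0 := hv.2 0 (lt_of_le_of_lt (Nat.zero_le k) hk)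
    cases k with
    | zero =>
      simp only [divStep]
      exact mem_roundOut prec (solve_mem (ne_zero_of_invI? hVi hv0) (inv_mem_of_invI? hv0 hVi)
        (hu.2 0 hk) h0)
    | succ n =>
      simp only [divStep]
      have hrec' := hrec n
      rw [Finset.Nat.sum_antidiagonal_eq_sum_range_succ (fun i j => v (i + 1) * w j)] at hrec'
      exact mem_roundOut prec (solve_mem (ne_zero_of_invI? hVi hv0) (inv_mem_of_invI? hv0 hVi)
        (sub_mem_sub (hu.2 (n + 1) hk) (sum_mem_isum fun i hi =>
          mul_mem_mul (hv.2 (i + 1) (by omega)) (hprev.2 (n - i) (by omega)))) hrec')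

/-- One step of the square-root recurrence (`R0 ∋ √(a)_0`, `H ∋ 1/(2√(a)_0)`).
[cite: Moore1979, §3.4 eqs. (3.18)–(3.19)] -/
def sqrtStep (A : List Iv) (R0 H : Iv) (prec : ℕ) (L : List Iv) : ℕ → Iv
  | 0 => R0
  | 1 => (H.mooreMul (coeff A 1)).roundOut prec
  | n + 2 => (H.mooreMul (coeff A (n + 2) -
      isum (fun i => (coeff L (i + 1)).mooreMul (coeff L (n - i + 1))) (n + 1))).roundOut prec

/-- **The square root `√a`** in interval Taylor arithmetic (Moore's `u^{1/2}`, division-free form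
of (3.19) obtained from the product rule (3.18) for `r · r = a`):
`(√a)_k = ( (a)_k − ∑_{j=1}^{k−1} (√a)_j (√a)_{k−j} ) / (2 √a)`, seeded by an enclosure `SQRT` of
`sqrt` at order `0`; `none` if the seed gives up or `0 ∈ 2 (√a)_0`.
[cite: Moore1979, §3.4 eqs. (3.18)–(3.19)] -/
def sqrtS (SQRT : Iv → Option Iv) (prec : ℕ) (A : List Iv) : Option (List Iv) :=
  (SQRT (coeff A 0)).bind fun R0 =>
    ((scale 2 R0).invI?).map fun H => recList (sqrtStep A R0 H prec) A.length

/-- Inclusion property of `sqrtS`: if `a ∈ A`, `r_0 = √a_0`, `2 (r_0 r_1) = a_1` and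
`2 (r_0 r_{n+2}) = a_{n+2} − ∑_{i+j=n} r_{i+1} r_{j+1}` for all `n`, then `r ∈ sqrtS SQRT prec A`.
[cite: Moore1979, §3.4 eqs. (3.18)–(3.19)] -/
theorem seqMem_sqrtS {SQRT : Iv → Option Iv} (hSQRT : SeedSoundOn (fun x => 0 < x) Real.sqrt SQRT)
    (prec : ℕ) {m : ℕ} {a r : ℕ → ℝ} {A R : List Iv} (ha : SeqMem m a A)
    (hR : sqrtS SQRT prec A = some R) (h0 : r 0 = Real.sqrt (a 0)) (h1 : 2 * (r 0 * r 1) = a 1)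
    (hrec : ∀ n : ℕ, 2 * (r 0 * r (n + 2)) =
      a (n + 2) - ∑ p ∈ antidiagonal n, r (p.1 + 1) * r (p.2 + 1)) :
    SeqMem m r R := by
  unfold sqrtS at hR
  rw [ha.1] at hR
  cases hR0 : SQRT (coeff A 0) with
  | none => rw [hR0] at hR; simp at hR
  | some R0 =>
    simp only [hR0, Option.bind_some] at hR
    cases hH : (scale 2 R0).invI? with
    | none => rw [hH] at hR; simp at hR
    | some H =>
      simp only [hH, Option.map_some, Option.some.injEq] at hR
      subst hR
      refine seqMem_recList _ fun k hk hprev => ?_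
      have ha0 := ha.2 0 (lt_of_le_of_lt (Nat.zero_le k) hk)
      have hr0 : r 0 ∈ R0.ratCast ℝ := by rw [h0]; exact (hSQRT hR0 ha0).2
      have h2r0 : (2 : ℝ) * r 0 ∈ (scale 2 R0).ratCast ℝ := by
        have := mem_scale 2 hr0
        rwa [Rat.cast_ofNat] at this
      have hne := ne_zero_of_invI? hH h2r0
      have hinv := inv_mem_of_invI? h2r0 hH
      cases k with
      | zero => exact hr0
      | succ k =>
        cases k with
        | zero =>
          simp only [sqrtStep]
          exact mem_roundOut prec (solve_mem hne hinv (ha.2 1 hk) (by rw [mul_assoc]; exact h1))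
        | succ n =>
          simp only [sqrtStep]
          have hrec' := hrec n
          rw [Finset.Nat.sum_antidiagonal_eq_sum_range_succ (fun i j => r (i + 1) * r (j + 1))]
            at hrec'
          refine mem_roundOut prec (solve_mem hne hinv (sub_mem_sub (ha.2 (n + 2) hk)
            (sum_mem_isum fun i hi => mul_mem_mul (hprev.2 (i + 1) (by omega))
              (hprev.2 (n - i + 1) (by omega)))) ?_)
          rw [mul_assoc]
          exact hrec'

/-! ### Bridge: Lie coefficients along a derivation satisfy Moore's recurrences -/

section Bridge

variable {A : Type*} [CommRing A] [Algebra ℝ A] (D : Derivation ℝ A A) (φ : A →ₐ[ℝ] ℝ)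

/-- The **evaluated Lie-coefficient sequence** `k ↦ φ ((k!)⁻¹ Dᵏ a)`.  For `A` an algebra of
smooth functions, `D` the Lie derivative of a vector field and `φ` the evaluation at a point `x`
these are the Taylor coefficients `(a)_k` at `t₀` of `a` along the solution through `x`
(Moore's `(x)_k`, generated by `(x)_k = (1/k)((x)_1)_{k−1}`). [cite: Moore1979, §3.4 eq. (3.17)] -/
noncomputable def coeffSeq (a : A) : ℕ → ℝ := fun k => φ (lieCoeff D k a)

/-- Unfolding `coeffSeq`. [cite: Moore1979, §3.4 eq. (3.17)] -/
@[simp] theorem coeffSeq_apply (a : A) (k : ℕ) : coeffSeq D φ a k = φ (lieCoeff D k a) := rfl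

variable {n : ℕ}

/-- Rule `u + v` for evaluated Lie coefficients. [cite: Moore1979, §3.4 eq. (3.18)] -/
theorem seqMem_coeffSeq_add {a b : A} {U V : List Iv} (ha : SeqMem n (coeffSeq D φ a) U)
    (hb : SeqMem n (coeffSeq D φ b) V) : SeqMem n (coeffSeq D φ (a + b)) (addS U V) :=
  (seqMem_addS ha hb).congr fun k => by simp [lieCoeff_add]

/-- Rule `u − v` for evaluated Lie coefficients. [cite: Moore1979, §3.4 eq. (3.18)] -/
theorem seqMem_coeffSeq_sub {a b : A} {U V : List Iv} (ha : SeqMem n (coeffSeq D φ a) U)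
    (hb : SeqMem n (coeffSeq D φ b) V) : SeqMem n (coeffSeq D φ (a - b)) (subS U V) :=
  (seqMem_subS ha hb).congr fun k => by simp [lieCoeff_sub]

/-- Rule `−u` for evaluated Lie coefficients. [cite: Moore1979, §3.4 eq. (3.18)] -/
theorem seqMem_coeffSeq_neg {a : A} {U : List Iv} (ha : SeqMem n (coeffSeq D φ a) U) :
    SeqMem n (coeffSeq D φ (-a)) (negS U) :=
  (seqMem_negS ha).congr fun k => by simp [lieCoeff_neg]

/-- Rule `q · u` (rational constant factor) for evaluated Lie coefficients.
[cite: Moore1979, §3.4, remark after (3.18)] -/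
theorem seqMem_coeffSeq_smul (q : ℚ) {a : A} {U : List Iv} (ha : SeqMem n (coeffSeq D φ a) U) :
    SeqMem n (coeffSeq D φ ((q : ℝ) • a)) (smulS q U) :=
  (seqMem_smulS q ha).congr fun k => by simp [lieCoeff_smul]

/-- The constant `q`: `(q)_0 = q`, `(q)_j = 0` (`j ≥ 1`).
[cite: Moore1979, §3.4, remark after (3.18)] -/
theorem seqMem_coeffSeq_const (q : ℚ) (m : ℕ) :
    SeqMem m (coeffSeq D φ (algebraMap ℝ A q)) (constS q m) :=
  seqMem_constS q m (by simp) fun k => by simp [lieCoeff_succ_algebraMap]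

/-- The constant `1`. [cite: Moore1979, §3.4, remark after (3.18)] -/
theorem seqMem_coeffSeq_one (m : ℕ) : SeqMem m (coeffSeq D φ 1) (constS 1 m) :=
  seqMem_constS 1 m (by simp) fun k => by simp [lieCoeff_succ_one]

/-- **Product rule** for evaluated Lie coefficients: `(uv)_k = ∑_{i+j=k} (u)_i (v)_j` is enclosed
by `mulS`. [cite: Moore1979, §3.4 eq. (3.18)] -/
theorem seqMem_coeffSeq_mul (prec : ℕ) {a b : A} {U V : List Iv}
    (ha : SeqMem n (coeffSeq D φ a) U) (hb : SeqMem n (coeffSeq D φ b) V) :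
    SeqMem n (coeffSeq D φ (a * b)) (mulS prec U V) :=
  seqMem_mulS prec ha hb fun k => by simp [lieCoeff_mul, map_sum, map_mul]

/-- Natural powers `uᵐ` by repeated products. [cite: Moore1979, §3.4 eq. (3.18)] -/
def powS (prec : ℕ) (U : List Iv) : ℕ → List Iv
  | 0 => constS 1 U.length
  | m + 1 => mulS prec (powS prec U m) U

/-- Rule `uᵐ` for evaluated Lie coefficients. [cite: Moore1979, §3.4 eq. (3.18)] -/
theorem seqMem_coeffSeq_pow (prec : ℕ) {a : A} {U : List Iv} (ha : SeqMem n (coeffSeq D φ a) U) :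
    ∀ m : ℕ, SeqMem n (coeffSeq D φ (a ^ m)) (powS prec U m)
  | 0 => by
    rw [pow_zero]
    show SeqMem n (coeffSeq D φ 1) (constS 1 U.length)
    rw [ha.1]
    exact seqMem_coeffSeq_one D φ n
  | m + 1 => by
    rw [pow_succ]
    exact seqMem_coeffSeq_mul D φ prec (seqMem_coeffSeq_pow prec ha m) ha

/-- **`eᵘ` along a derivation**: if `D e = e · D u` and `φ e = exp (φ u)`, the evaluated Lie
coefficients of `e` are enclosed by `expS`. [cite: Moore1979, §3.4 eq. (3.19)] -/
theorem seqMem_coeffSeq_exp {EXP : Iv → Option Iv} (hEXP : SeedSound Real.exp EXP) (prec : ℕ)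
    {e u : A} (h : D e = e * D u) (hφ : φ e = Real.exp (φ u)) {U E : List Iv}
    (hU : SeqMem n (coeffSeq D φ u) U) (hE : expS EXP prec U = some E) :
    SeqMem n (coeffSeq D φ e) E :=
  seqMem_expS hEXP prec hU hE (by simpa using hφ) fun k => by
    simpa [map_nsmul, nsmul_eq_mul, map_sum, map_mul] using
      congrArg (fun x => φ x) (lieCoeff_exp_rule D h k)

/-- **`sin u`, `cos u` along a derivation**: if `D s = c · D u`, `D c = −(s · D u)`,
`φ s = sin (φ u)`, `φ c = cos (φ u)`, the evaluated Lie coefficients of `s` and `c` are enclosed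
by the components of `sinCosS`. [cite: Moore1979, §3.4 eq. (3.19)] -/
theorem seqMem_coeffSeq_sinCos {CS : Iv → Option (Iv × Iv)} (hCS : SeedSound₂ Real.sin Real.cos CS)
    (prec : ℕ) {s c u : A} (hs : D s = c * D u) (hc : D c = -(s * D u))
    (hφs : φ s = Real.sin (φ u)) (hφc : φ c = Real.cos (φ u)) {U : List Iv} {W : List (Iv × Iv)}
    (hU : SeqMem n (coeffSeq D φ u) U) (hW : sinCosS CS prec U = some W) :
    SeqMem n (coeffSeq D φ s) (W.map Prod.fst) ∧ SeqMem n (coeffSeq D φ c) (W.map Prod.snd) :=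
  seqMem_sinCosS hCS prec hU hW (by simpa using hφs) (by simpa using hφc)
    (fun k => by
      simpa [map_nsmul, nsmul_eq_mul, map_sum, map_mul] using
        congrArg (fun x => φ x) (lieCoeff_sin_rule D hs k))
    (fun k => by
      simpa [map_nsmul, nsmul_eq_mul, map_sum, map_mul, map_neg] using
        congrArg (fun x => φ x) (lieCoeff_cos_rule D hc k))

/-- **`log u` along a derivation**: if `u · D l = D u` and `φ l = log (φ u)`, the evaluated Lie
coefficients of `l` are enclosed by `logS`. [cite: Moore1979, §3.4 eq. (3.19)] -/
theorem seqMem_coeffSeq_log {LOG : Iv → Option Iv}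
    (hLOG : SeedSoundOn (fun x => 0 < x) Real.log LOG) (prec : ℕ) {l u : A} (h : u * D l = D u)
    (hφ : φ l = Real.log (φ u)) {U L : List Iv} (hU : SeqMem n (coeffSeq D φ u) U)
    (hL : logS LOG prec U = some L) :
    SeqMem n (coeffSeq D φ l) L :=
  seqMem_logS hLOG prec hU hL (by simpa using hφ) fun n => by
    simpa [map_nsmul, nsmul_eq_mul, map_sum, map_mul, map_sub] using
      congrArg (fun x => φ x) (lieCoeff_log_rule D h n)

/-- **`1/v` along a derivation**: if `v · w = 1`, the evaluated Lie coefficients of `w` are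
enclosed by `invS`. [cite: Moore1979, §3.4 eq. (3.18)] -/
theorem seqMem_coeffSeq_inv (prec : ℕ) {v w : A} (h : v * w = 1) {V W : List Iv}
    (hV : SeqMem n (coeffSeq D φ v) V) (hW : invS prec V = some W) :
    SeqMem n (coeffSeq D φ w) W :=
  seqMem_invS prec hV hW (by simpa [map_mul] using congrArg (fun x => φ x) h) fun n => by
    simpa [map_sum, map_mul, map_neg] using congrArg (fun x => φ x) (lieCoeff_inv_rule D h n)

/-- **`u/v` along a derivation**: if `v · w = u`, the evaluated Lie coefficients of `w` are
enclosed by `divS`. [cite: Moore1979, §3.4 eq. (3.18)] -/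
theorem seqMem_coeffSeq_div (prec : ℕ) {u v w : A} (h : v * w = u) {U V W : List Iv}
    (hU : SeqMem n (coeffSeq D φ u) U) (hV : SeqMem n (coeffSeq D φ v) V)
    (hW : divS prec U V = some W) : SeqMem n (coeffSeq D φ w) W :=
  seqMem_divS prec hU hV hW (by simpa [map_mul] using congrArg (fun x => φ x) h) fun n => by
    simpa [map_sum, map_mul, map_sub] using congrArg (fun x => φ x) (lieCoeff_div_rule D h n)

/-- **`√a` along a derivation**: if `r · r = a` and `φ r = √(φ a)`, the evaluated Lie
coefficients of `r` are enclosed by `sqrtS`. [cite: Moore1979, §3.4 eqs. (3.18)–(3.19)] -/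
theorem seqMem_coeffSeq_sqrt {SQRT : Iv → Option Iv}
    (hSQRT : SeedSoundOn (fun x => 0 < x) Real.sqrt SQRT) (prec : ℕ) {r a : A} (h : r * r = a)
    (hφ : φ r = Real.sqrt (φ a)) {A' R : List Iv} (hA : SeqMem n (coeffSeq D φ a) A')
    (hR : sqrtS SQRT prec A' = some R) : SeqMem n (coeffSeq D φ r) R :=
  seqMem_sqrtS hSQRT prec hA hR (by simpa using hφ)
    (by
      have h1 := congrArg (fun x => φ x) (lieCoeff_sqrt_rule_one D h)
      simp only [map_nsmul, map_mul] at h1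
      simpa [nsmul_eq_mul] using h1)
    fun n => by
      have h2 := congrArg (fun x => φ x) (lieCoeff_sqrt_rule D h n)
      simp only [map_nsmul, map_mul, map_sub, map_sum] at h2
      simpa [nsmul_eq_mul] using h2

end Bridge

/-! ### Concrete seeds from the multiprecision kernels -/

namespace Seed

open Literature.Analysis.ValidatedNumerics.NumericsMP

/-- A rational interval as a fixed-point interval at scale `2^p` (endpoints rounded outward).
[cite: Moore1966, §3.2 "rounded interval arithmetic"] -/
def toMI (p : ℕ) (I : Iv) : MI := ⟨⌊I.fst * 2 ^ p⌋, ⌈I.snd * 2 ^ p⌉⟩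

/-- Outward rounding to the fixed-point grid preserves inclusion.
[cite: Moore1966, §3.2 "rounded interval arithmetic"] -/
theorem mem_toMI (p : ℕ) {I : Iv} {x : ℝ} (hx : x ∈ I.ratCast ℝ) : MI.mem (2 ^ p) x (toMI p I) := by
  obtain ⟨h1, h2⟩ := mem_ratCast_iff.mp hx
  have hS : ((2 ^ p : ℕ) : ℝ) = (2 : ℝ) ^ p := by norm_num
  have hf : ((⌊I.fst * 2 ^ p⌋ : ℤ) : ℝ) ≤ (I.fst : ℝ) * 2 ^ p := by
    exact_mod_cast Int.floor_le (I.fst * 2 ^ p)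
  have hc : (I.snd : ℝ) * 2 ^ p ≤ ((⌈I.snd * 2 ^ p⌉ : ℤ) : ℝ) := by
    exact_mod_cast Int.le_ceil (I.snd * 2 ^ p)
  refine ⟨?_, ?_⟩
  · show ((⌊I.fst * 2 ^ p⌋ : ℤ) : ℝ) ≤ x * ((2 ^ p : ℕ) : ℝ)
    rw [hS]
    exact hf.trans (mul_le_mul_of_nonneg_right h1 (by positivity))
  · show x * ((2 ^ p : ℕ) : ℝ) ≤ ((⌈I.snd * 2 ^ p⌉ : ℤ) : ℝ)
    rw [hS]
    exact (mul_le_mul_of_nonneg_right h2 (by positivity)).trans hc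

/-- A fixed-point interval at scale `2^p` as a rational interval.
[cite: Moore1966, §3.2 "rounded interval arithmetic"] -/
def ofMI (p : ℕ) (J : MI) : Iv :=
  ⟨(((min J.lo J.hi : ℤ) : ℚ) / 2 ^ p, ((max J.lo J.hi : ℤ) : ℚ) / 2 ^ p),
    div_le_div_of_nonneg_right (by exact_mod_cast min_le_max) (by positivity)⟩

/-- Reading a fixed-point interval back as a rational interval preserves inclusion.
[cite: Moore1966, §3.2 "rounded interval arithmetic"] -/
theorem mem_ofMI (p : ℕ) {J : MI} {x : ℝ} (h : MI.mem (2 ^ p) x J) : x ∈ (ofMI p J).ratCast ℝ := by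
  obtain ⟨h1, h2⟩ := h
  have hS : ((2 ^ p : ℕ) : ℝ) = (2 : ℝ) ^ p := by norm_num
  rw [hS] at h1 h2
  have hp : (0 : ℝ) < 2 ^ p := by positivity
  have hlo : ((min J.lo J.hi : ℤ) : ℝ) ≤ x * 2 ^ p :=
    le_trans (by exact_mod_cast min_le_left J.lo J.hi) h1
  have hhi : x * 2 ^ p ≤ ((max J.lo J.hi : ℤ) : ℝ) :=
    le_trans h2 (by exact_mod_cast le_max_right J.lo J.hi)
  rw [mem_ratCast_iff]
  refine ⟨?_, ?_⟩
  · show (((((min J.lo J.hi : ℤ) : ℚ) / 2 ^ p : ℚ)) : ℝ) ≤ x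
    rw [Rat.cast_div, Rat.cast_intCast, Rat.cast_pow, Rat.cast_ofNat, div_le_iff₀ hp]
    exact hlo
  · show x ≤ (((((max J.lo J.hi : ℤ) : ℚ) / 2 ^ p : ℚ)) : ℝ)
    rw [Rat.cast_div, Rat.cast_intCast, Rat.cast_pow, Rat.cast_ofNat, le_div_iff₀ hp]
    exact hhi

/-- **Exponential seed**: `exp` on a rational interval via `MI.exp` (argument halving, Taylor
polynomial with `K` terms, `k` squarings) at scale `2^p`. [cite: BrentZimmermann2010, §4.3.1] -/
def exp (p K k : ℕ) (I : Iv) : Option Iv := (MI.exp (2 ^ p) K k (toMI p I)).map (ofMI p)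

/-- Soundness of the exponential seed. [cite: Moore1966, Theorem 3.1] -/
theorem exp_sound (p K k : ℕ) : SeedSound Real.exp (exp p K k) := by
  intro I J x hJ hx
  unfold exp at hJ
  cases hY : MI.exp (2 ^ p) K k (toMI p I) with
  | none => rw [hY] at hJ; simp at hJ
  | some Y =>
    simp only [hY, Option.map_some, Option.some.injEq] at hJ
    subst hJ
    exact mem_ofMI p (MI.mem_exp (by positivity) hY (mem_toMI p hx))

/-- **Logarithm seed** (positive arguments only): `log` via `MI.logPos` at scale `2^p`.
[cite: BrentZimmermann2010, §4.4.2] -/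
def log (p K : ℕ) (I : Iv) : Option Iv := (MI.logPos (2 ^ p) K (toMI p I)).map (ofMI p)

/-- Soundness of the logarithm seed, including positivity of the argument.
[cite: Moore1966, Theorem 3.1] -/
theorem log_sound (p K : ℕ) : SeedSoundOn (fun x => 0 < x) Real.log (log p K) := by
  intro I J x hJ hx
  unfold log at hJ
  cases hY : MI.logPos (2 ^ p) K (toMI p I) with
  | none => rw [hY] at hJ; simp at hJ
  | some Y =>
    simp only [hY, Option.map_some, Option.some.injEq] at hJ
    subst hJ
    have h := MI.mem_logPos (by positivity) hY (mem_toMI p hx)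
    exact ⟨h.1, mem_ofMI p h.2⟩

/-- **Sine/cosine seed**: `(sin, cos)` via the complex doubling scheme `PolyMP.cisPt`
(`e^{ix} = (e^{ix/2^k})^{2^k}`) at scale `2^p`. [cite: BrentZimmermann2010, §4.3.1] -/
def sinCos (p K k : ℕ) (I : Iv) : Option (Iv × Iv) :=
  (PolyMP.cisPt (2 ^ p) K k (toMI p I)).map fun Y => (ofMI p Y.im, ofMI p Y.re)

/-- Soundness of the sine/cosine seed. [cite: Moore1966, Theorem 3.1] -/
theorem sinCos_sound (p K k : ℕ) : SeedSound₂ Real.sin Real.cos (sinCos p K k) := by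
  intro I P x hP hx
  unfold sinCos at hP
  cases hY : PolyMP.cisPt (2 ^ p) K k (toMI p I) with
  | none => rw [hY] at hP; simp at hP
  | some Y =>
    simp only [hY, Option.map_some, Option.some.injEq] at hP
    subst hP
    exact ⟨mem_ofMI p (PolyMP.mem_sin_of_cisPt (by positivity) hY (mem_toMI p hx)),
      mem_ofMI p (PolyMP.mem_cos_of_cisPt (by positivity) hY (mem_toMI p hx))⟩

/-- **Square-root seed** (positive arguments only): `sqrtI` (bisection bounds with `iters`
steps at precision `prec`), refusing intervals that are not strictly positive.
[cite: Moore1966, Theorem 3.1] -/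
def sqrt (prec iters : ℕ) (I : Iv) : Option Iv :=
  if 0 < I.fst then some (I.sqrtI prec iters) else none

/-- Soundness of the square-root seed, including positivity of the argument.
[cite: Moore1966, Theorem 3.1] -/
theorem sqrt_sound (prec iters : ℕ) : SeedSoundOn (fun x => 0 < x) Real.sqrt (sqrt prec iters) := by
  intro I J x hJ hx
  unfold sqrt at hJ
  split_ifs at hJ with h0
  simp only [Option.some.injEq] at hJ
  subst hJ
  have h0' : (0 : ℝ) < I.fst := by exact_mod_cast h0
  exact ⟨h0'.trans_le (mem_ratCast_iff.mp hx).1, sqrt_mem_sqrtI prec iters hx⟩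

end Seed

/-! ### Kernel examples -/

/-- The reciprocal rule on `v(t) = 1 + t` about `t₀ = 0` to order 4 returns exactly the
coefficients `1, −1, 1, −1, 1` of `1/(1+t)`. [cite: Moore1979, §3.4 eq. (3.18)] -/
example : ((invS 20 [1, 1, 0, 0, 0]).map fun L => L.map NonemptyInterval.toProd) =
    some [(1, 1), (-1, -1), (1, 1), (-1, -1), (1, 1)] := by
  decide +kernel

/-- The exponential rule on `u(t) = t` about `t₀ = 0` to order 5 with the multiprecision seed:
the computed coefficient intervals contain `1/k!`. [cite: Moore1979, §3.4 eq. (3.19)] -/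
example : ((expS (Seed.exp 20 10 3) 24 [0, 1, 0, 0, 0, 0]).map fun E =>
      (List.range 6).all fun k =>
        decide
          ((coeff E k).fst ≤ 1 / (k.factorial : ℚ) ∧ 1 / (k.factorial : ℚ) ≤ (coeff E k).snd)) =
    some true := by
  decide +kernel

end ITaylor

end Literature.Analysis.ValidatedNumerics
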